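import Summits.SmoothPoincare4.SmoothPoincare4.Theorems.SymplecticOrigamiGromovRecognitionRelEndStubTameJAux
import Literature.Geometry.Symplectic.GromovR4RelEndProofs
import Literature.Geometry.Symplectic.SteinBall
import Mathlib
import HarnessLib

/-!
# The end structure `ψ*(i ⊕ i)`: a smooth section of `End(TM)` where `dψ` is invertible
(helper file 5 for stub `stub_tameJ` of line `cross-cap-laurent`, crux `GromovRecognitionRelEnd`,
item stmt-SmoothPoincare4-11009)

For a map `ψ : M → ℝ⁴` from a `4`-manifold modelled on `ℝ⁴`, the field of endomorphisms
`J_ψ(x) := (dψ_x)⁻¹ ∘ J₀ ∘ dψ_x` (`J₀ = stdComplexStructure = i ⊕ i`, `(dψ_x)⁻¹` Mathlib's total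
`ContinuousLinearMap.inverse`) is the pull-back `ψ*(i ⊕ i)` wherever `dψ_x` is invertible.
This file proves:

* `contMDiffOn_endPullback` (registered helper sub-goal `helper_endJSmooth`) — on an open set
  `U` where `ψ` is `C^∞` with injective differential, `x ↦ (x, J_ψ x)` is a `C^∞` section of the
  endomorphism bundle: in the tangent trivialisation at `y ∈ U` it reads `D(x)⁻¹ J₀ D(x)` with
  `D(x) = dψ_x ∘ φₓ⁻¹` the differential of `ψ ∘ (extChartAt y)⁻¹` (`contMDiffAt_mfderiv_comp_symmL`),
  and inversion is smooth at the invertible `D(y)` (`IsInvertible.contDiffAt_map_inverse`);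
* the pointwise algebra of `d⁻¹ J₀ d` for an invertible `d ∈ End(ℝ⁴)` (to be used with
  `d = dψ_x`, all tangent spaces being `ℝ⁴`): `(d⁻¹ J₀ d)² = -1` (`pullbackJ_mul_self`),
  `d (d⁻¹ J₀ d v) = J₀ (d v)` (`apply_pullbackJ`), conjugation `φ (d⁻¹ J₀ d) φ' = (d φ')⁻¹ J₀ (d φ')`
  for `φ'⁻¹ = φ` (`conj_pullbackJ`), and, under the pull-back clause `σ(v, w) = ω₀(d v, d w)`
  (hypothesis H10 of the crux), `σ(v, d⁻¹ J₀ d w) = ⟪d v, d w⟫` (`form_pullbackJ_eq_inner`) — so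
  `σ(·, J_ψ ·)` is symmetric positive definite, i.e. `J_ψ` is `σ`-compatible (McDuff–Salamon
  (2017), §4.1: `ω₀(ζ, J₀ζ') = ⟨ζ, ζ'⟩`);
* `isInvertible_of_injective` — an injective endomorphism of `ℝ⁴` is invertible.

Everything is proved; no definition, no named fact.

References: D. McDuff, D. Salamon, *Introduction to Symplectic Topology*, 3rd ed. (2017), §1.1
(1.1.21), §4.1 [McDuffSalamon2017]; J. M. Lee, *Introduction to Smooth Manifolds* (2013),
Prop. 10.22 [LeeSmoothManifolds2013].
-/

noncomputable section

-- the registered namespace `Summit.SmoothPoincare4.SmoothPoincare4.Theorems…` repeats a component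
set_option linter.dupNamespace false

open scoped Manifold ContDiff Topology RealInnerProductSpace
open Bundle Set Function Filter Literature.Geometry.Symplectic

namespace Summit.SmoothPoincare4.SmoothPoincare4.Theorems.GromovRecognitionRelEnd.CrossCapLaurent

/-! ### Pointwise algebra of `d⁻¹ J₀ d` on `ℝ⁴` -/

/-- An injective endomorphism of `ℝ⁴` is invertible. [folklore] -/
theorem isInvertible_of_injective (d : EuclideanSpace ℝ (Fin 4) →L[ℝ] EuclideanSpace ℝ (Fin 4))
    (h : Injective d) : d.IsInvertible := by
  refine ⟨(d.toLinearMap.linearEquivOfInjective h rfl).toContinuousLinearEquiv, ?_⟩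
  ext v
  rfl

/-- `ω₀(a, J₀ b) = ⟪a, b⟫` (McDuff–Salamon (2017), (1.1.21)). [cite: McDuffSalamon2017, §1.1 (1.1.21)] -/
theorem stdSymplecticForm_stdComplexStructure (a b : EuclideanSpace ℝ (Fin 4)) :
    stdSymplecticForm a (stdComplexStructure b) = ⟪a, b⟫ := by
  rw [Literature.Topology.FourManifolds.inner_fin_four]
  simp only [stdSymplecticForm, stdComplexStructure_apply_zero, stdComplexStructure_apply_one,
    stdComplexStructure_apply_two, stdComplexStructure_apply_three]
  ring

section Pure

variable {d : EuclideanSpace ℝ (Fin 4) →L[ℝ] EuclideanSpace ℝ (Fin 4)} (hd : d.IsInvertible)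
include hd

/-- `d (d⁻¹ J₀ d v) = J₀ (d v)` (`ψ` is `(J_ψ, i ⊕ i)`-holomorphic). [folklore] -/
theorem apply_pullbackJ (v : EuclideanSpace ℝ (Fin 4)) :
    d ((d.inverse.comp (stdComplexStructure.comp d)) v) = stdComplexStructure (d v) :=
  hd.self_apply_inverse _

/-- `(d⁻¹ J₀ d)² = -1`. [folklore] -/
theorem pullbackJ_mul_self :
    (d.inverse.comp (stdComplexStructure.comp d)) * (d.inverse.comp (stdComplexStructure.comp d)) =
      -1 := by
  refine ContinuousLinearMap.ext fun v ↦ ?_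
  show d.inverse (stdComplexStructure (d (d.inverse (stdComplexStructure (d v))))) = -v
  rw [hd.self_apply_inverse, stdComplexStructure_sq, map_neg, hd.inverse_apply_self]

/-- **The pull-back clause makes `d⁻¹ J₀ d` compatible**: if `σ(v, w) = ω₀(d v, d w)` then
`σ(v, d⁻¹ J₀ d w) = ⟪d v, d w⟫` (symmetric, positive definite). [cite: McDuffSalamon2017, §4.1] -/
theorem form_pullbackJ_eq_inner (σ : EuclideanSpace ℝ (Fin 4) [⋀^Fin 2]→L[ℝ] ℝ)
    (hσ : ∀ v w : EuclideanSpace ℝ (Fin 4), σ ![v, w] = stdSymplecticForm (d v) (d w))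
    (v w : EuclideanSpace ℝ (Fin 4)) :
    σ ![v, (d.inverse.comp (stdComplexStructure.comp d)) w] = ⟪d v, d w⟫ := by
  rw [hσ, apply_pullbackJ hd, stdSymplecticForm_stdComplexStructure]

/-- Conjugating `d⁻¹ J₀ d` by a frame: `φ (d⁻¹ J₀ d) φ' = (d φ')⁻¹ J₀ (d φ')` when `φ'⁻¹ = φ`
(`φ = φₓ`, `φ' = φₓ⁻¹` the tangent trivialisation). [folklore] -/
theorem conj_pullbackJ (φ φ' : EuclideanSpace ℝ (Fin 4) →L[ℝ] EuclideanSpace ℝ (Fin 4))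
    (hφ : φ'.inverse = φ) :
    φ.comp ((d.inverse.comp (stdComplexStructure.comp d)).comp φ') =
      (d.comp φ').inverse.comp (stdComplexStructure.comp (d.comp φ')) := by
  rw [hd.inverse_comp_of_left, hφ]
  simp only [ContinuousLinearMap.comp_assoc]

end Pure

/-! ### Smoothness of the section `x ↦ J_ψ(x)` -/

variable {M : Type*} [TopologicalSpace M] [ChartedSpace (EuclideanSpace ℝ (Fin 4)) M]
  [IsManifold (𝓡 4) ∞ M]

/-- **`ψ*(i ⊕ i)` is a smooth section of `End(TM)` over an open set where `ψ` is a local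
diffeomorphism.** For `U` open, `ψ` of class `C^∞` on `U` with injective differential at every
point of `U`, `x ↦ (x, (dψ_x)⁻¹ J₀ dψ_x)` is `C^∞` on `U` as a map into the endomorphism bundle.
In the tangent trivialisation at `y ∈ U` the section reads `D(x)⁻¹ J₀ D(x)`,
`D(x) = dψ_x ∘ φₓ⁻¹`, a smooth expression (Lee (2013), Prop. 10.22; inversion is smooth).
[cite: LeeSmoothManifolds2013, Prop. 10.22] -/
theorem contMDiffOn_endPullback {ψ : M → EuclideanSpace ℝ (Fin 4)} {U : Set M} (hU : IsOpen U)
    (hψ : ContMDiffOn (𝓡 4) 𝓘(ℝ, EuclideanSpace ℝ (Fin 4)) ∞ ψ U)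
    (hinj : ∀ x ∈ U, Injective (mfderiv (𝓡 4) 𝓘(ℝ, EuclideanSpace ℝ (Fin 4)) ψ x)) :
    ContMDiffOn (𝓡 4) ((𝓡 4).prod 𝓘(ℝ, EuclideanSpace ℝ (Fin 4) →L[ℝ] EuclideanSpace ℝ (Fin 4))) ∞
      (fun x ↦ TotalSpace.mk' (EuclideanSpace ℝ (Fin 4) →L[ℝ] EuclideanSpace ℝ (Fin 4))
        (E := fun x : M ↦ TangentSpace (𝓡 4) x →L[ℝ] TangentSpace (𝓡 4) x) x
        ((mfderiv (𝓡 4) 𝓘(ℝ, EuclideanSpace ℝ (Fin 4)) ψ x).inverse.comp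
          (stdComplexStructure.comp (mfderiv (𝓡 4) 𝓘(ℝ, EuclideanSpace ℝ (Fin 4)) ψ x)))) U := by
  intro y hy
  apply ContMDiffAt.contMDiffWithinAt
  rw [contMDiffAt_endSection_iff]
  -- `D(x) = dψ_x ∘ φₓ⁻¹`
  set D : M → EuclideanSpace ℝ (Fin 4) →L[ℝ] EuclideanSpace ℝ (Fin 4) := fun x ↦
    (mfderiv (𝓡 4) 𝓘(ℝ, EuclideanSpace ℝ (Fin 4)) ψ x).comp
      ((trivializationAt (EuclideanSpace ℝ (Fin 4)) (TangentSpace (𝓡 4)) y).symmL ℝ x) with hD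
  have hDs : ContMDiffAt (𝓡 4) 𝓘(ℝ, EuclideanSpace ℝ (Fin 4) →L[ℝ] EuclideanSpace ℝ (Fin 4)) ∞ D y :=
    contMDiffAt_mfderiv_comp_symmL (hψ.contMDiffAt (hU.mem_nhds hy))
  have hDy : (D y).IsInvertible := by
    have : D y = (mfderiv (𝓡 4) 𝓘(ℝ, EuclideanSpace ℝ (Fin 4)) ψ y :
        EuclideanSpace ℝ (Fin 4) →L[ℝ] EuclideanSpace ℝ (Fin 4)) := by
      simp only [hD]
      rw [symmL_trivializationAt_self]
      ext v
      rfl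
    rw [this]
    exact isInvertible_of_injective _ (hinj y hy)
  have hinv : ContMDiffAt (𝓡 4) 𝓘(ℝ, EuclideanSpace ℝ (Fin 4) →L[ℝ] EuclideanSpace ℝ (Fin 4)) ∞
      (fun x ↦ (D x).inverse) y :=
    hDy.contDiffAt_map_inverse.comp_contMDiffAt hDs
  have hJ : ContMDiffAt (𝓡 4) 𝓘(ℝ, EuclideanSpace ℝ (Fin 4) →L[ℝ] EuclideanSpace ℝ (Fin 4)) ∞
      (fun _ : M ↦ (stdComplexStructure : EuclideanSpace ℝ (Fin 4) →L[ℝ] EuclideanSpace ℝ (Fin 4))) y :=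
    contMDiffAt_const
  refine (hinv.clm_comp (hJ.clm_comp hDs)).congr_of_eventuallyEq ?_
  filter_upwards [hU.mem_nhds hy,
    (chartAt (EuclideanSpace ℝ (Fin 4)) y).open_source.mem_nhds (mem_chart_source _ y)] with x hxU hx
  have hx' : x ∈ (trivializationAt (EuclideanSpace ℝ (Fin 4)) (TangentSpace (𝓡 4)) y).baseSet := by
    simpa using hx
  -- `(φₓ⁻¹)⁻¹ = φₓ`
  have hsymm : ((trivializationAt (EuclideanSpace ℝ (Fin 4)) (TangentSpace (𝓡 4)) y).symmL ℝ x :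
      EuclideanSpace ℝ (Fin 4) →L[ℝ] EuclideanSpace ℝ (Fin 4)).inverse =
      (trivializationAt (EuclideanSpace ℝ (Fin 4)) (TangentSpace (𝓡 4)) y).continuousLinearMapAt ℝ x := by
    rw [← (trivializationAt (EuclideanSpace ℝ (Fin 4))
        (TangentSpace (𝓡 4)) y).symm_continuousLinearEquivAt_eq' hx',
      ContinuousLinearMap.inverse_equiv, ContinuousLinearEquiv.symm_symm,
      (trivializationAt (EuclideanSpace ℝ (Fin 4)) (TangentSpace (𝓡 4)) y).coe_continuousLinearEquivAt_eq' hx']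
  exact conj_pullbackJ (isInvertible_of_injective _ (hinj x hxU)) _ _ hsymm

/-! ### Registered helper sub-goal -/

/-- **Registered helper sub-goal `helper_endJSmooth`** (`contMDiffOn_endPullback` for `M : Type`):
over an open set where `ψ : M → ℝ⁴` is `C^∞` with injective differential, `ψ*(i ⊕ i)` is a `C^∞`
section of the endomorphism bundle of `TM`. [cite: LeeSmoothManifolds2013, Prop. 10.22] -/
theorem helper_endJSmooth : ∀ (M : Type) [TopologicalSpace M]
    [ChartedSpace (EuclideanSpace ℝ (Fin 4)) M] [IsManifold (𝓡 4) ∞ M]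
    (ψ : M → EuclideanSpace ℝ (Fin 4)) (U : Set M), IsOpen U →
    ContMDiffOn (𝓡 4) 𝓘(ℝ, EuclideanSpace ℝ (Fin 4)) ∞ ψ U →
    (∀ x ∈ U, Function.Injective (mfderiv (𝓡 4) 𝓘(ℝ, EuclideanSpace ℝ (Fin 4)) ψ x)) →
    ContMDiffOn (𝓡 4) ((𝓡 4).prod 𝓘(ℝ, EuclideanSpace ℝ (Fin 4) →L[ℝ] EuclideanSpace ℝ (Fin 4))) ∞
      (fun x ↦ Bundle.TotalSpace.mk' (EuclideanSpace ℝ (Fin 4) →L[ℝ] EuclideanSpace ℝ (Fin 4))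
        (E := fun x : M ↦ TangentSpace (𝓡 4) x →L[ℝ] TangentSpace (𝓡 4) x) x
        ((mfderiv (𝓡 4) 𝓘(ℝ, EuclideanSpace ℝ (Fin 4)) ψ x).inverse.comp
          (Literature.Geometry.Symplectic.stdComplexStructure.comp
            (mfderiv (𝓡 4) 𝓘(ℝ, EuclideanSpace ℝ (Fin 4)) ψ x)))) U :=
  fun _ _ _ _ _ _ hU hψ hinj ↦ contMDiffOn_endPullback hU hψ hinj

end Summit.SmoothPoincare4.SmoothPoincare4.Theorems.GromovRecognitionRelEnd.CrossCapLaurent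

end
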